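import Summits.KontsevichZagierPeriods.KontsevichZagierPeriods.Theorems.HurwitzMicroSectorsNormalFormPrincipleRatVanishing
import Summits.KontsevichZagierPeriods.KontsevichZagierPeriods.Theorems.AbelContractionRealHyperellipticSectorPortQuadReduction
import Summits.KontsevichZagierPeriods.KontsevichZagierPeriods.Theorems.AbelContractionRealHyperellipticSectorPortAngLattice

/-!
# Route AbelContraction — `RealHyperellipticSector` (crux stmt-KontsevichZagierPeriods-12475):
# the dimension-certified port, layer 7 — Conjecture 1 inside dimension one on the unit box

Helper file of the line `Lines/birth.lean` (stub `stub_bakerAlg`, `--supports` the crux): the port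
of `Theorems/HurwitzMicroSectorsNormalFormPrincipleRatVanishing.lean` (namespace
`…NormalFormPrinciple.PiBox.Dlog`) INTO THE BUDGET `KZ.relationsLE 1`: every box-rational
representation `[(0,1), p/q]` of dimension one whose denominator (over the real algebraic numbers)
divides a rational polynomial without zeros on `[0,1]` is a mixed normal form in
`FormalRep ⧸ relationsLE 1` (`nfD_of_dvd`: peel real roots and conjugate pairs, by moves among
representations of dimension `≤ 1`); hence a vanishing value forces a TRUNCATED relation
(`box_rat_mem_relationsLE`, registered sub-goal, via `Port.Dlog.nfD_eq_zero_of_eval_eq_zero` and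
Baker), and equal values force `KZ.EquivalentLE 1` (`box_rat_equivalentLE_of_value_eq`).

The algebra (`exists_root_or_quad`, `exists_peel_quad`, `BoxAlgSplitK4.exists_peel_poleK`,
`exists_quadRep'`, the carrier families, `exists_rep_unit`) is reused from the originals.

Sources: M. Kontsevich, D. Zagier, *Periods* (2001), §1.2 Conjecture 1 [KontsevichZagier2001];
A. Baker, *Transcendental Number Theory* (1975), Thm. 2.1. No definitions are introduced.
-/

noncomputable section

open MeasureTheory Set
open scoped Polynomial
open Literature.NumberTheory.Transcendental Literature.NumberTheory.Transcendental.KZ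
open Literature.ModelTheory.ExponentialFields (IsSemialgebraic)
open Summit.KontsevichZagierPeriods.AbelContraction.AbelContractionLemma
  (mem_relationsLE_of_integrandAdd)

namespace Summit.KontsevichZagierPeriods.AbelContraction.RealHyperellipticSector.Port

namespace Dlog

open Summit.KontsevichZagierPeriods.HurwitzMicroSectors.NormalFormPrinciple
  (BoxAlgSplitK4.exists_peel_poleK)
open Summit.KontsevichZagierPeriods.HurwitzMicroSectors.NormalFormPrinciple.PiBox
  (AlgSplitK5.exists_repK_unit AlgSplitK5.isAlgebraic_coeK)
open Summit.KontsevichZagierPeriods.HurwitzMicroSectors.NormalFormPrinciple.PiBox.Dlog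
  (exists_carrierA exists_ptCarrierA exists_angCarrier exists_quadRep' exists_root_or_quad
    exists_peel_quad exists_rep_unit quad_pos)

/-- **Every box-rational representation on the unit slab whose denominator divides a rational
polynomial without zeros on `[0,1]` is in mixed normal form** (induction on `deg q` over the real
algebraic numbers: peel a real root — `BoxAlgSplitK4.exists_peel_poleK`, `SiegeK3.nfA_pole_one`, `nfA_pole_high` — or a
conjugate pair of non-real roots — `exists_root_or_quad`, `exists_peel_quad`, `nfD_quad`).
(inside the budget `relationsLE 1`) [cite: KontsevichZagier2001, §1.2] -/
theorem nfD_of_dvd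
    {RA : ℝ → ℝ → ℝ → IntegralRep 1} {ZA : ℝ → IntegralRep 0} {RG : ℝ → ℝ → IntegralRep 1}
    (hR : ∀ a b c, IsAlgebraic ℚ a → IsAlgebraic ℚ b → IsAlgebraic ℚ c → 0 < a →
      (RA a b c).domain = {x | x 0 ∈ Set.Ioo a b} ∧ (RA a b c).integrand = fun x => c / x 0)
    (hZ : ∀ r, IsAlgebraic ℚ r → (ZA r).domain = univ ∧ (ZA r).integrand = fun _ => r)
    (hRG : ∀ t d, IsAlgebraic ℚ t → IsAlgebraic ℚ d →
      (RG t d).domain = {x | x 0 ∈ Set.Ioo 0 t} ∧ (RG t d).integrand = fun x => d / (1 + x 0 ^ 2))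
    {q₀ : ℚ[X]} (hq₀ : q₀ ≠ 0) :
    ∀ (d : ℕ) (p q : (algebraicClosure ℚ ℝ)[X]) (N : IntegralRep 1), q ≠ 0 → q.natDegree ≤ d →
      q ∣ q₀.map (algebraMap ℚ (algebraicClosure ℚ ℝ)) →
      (∀ t ∈ Set.Icc (0:ℝ) 1, (Polynomial.aeval t q : ℝ) ≠ 0) →
      N.domain = {x | x 0 ∈ Set.Ioo (0:ℝ) 1} →
      EqOn N.integrand (fun x => (Polynomial.aeval (x 0) p : ℝ) / Polynomial.aeval (x 0) q) N.domain →
      ∃ (r : ℝ) (k : ℕ) (u c : Fin k → ℝ) (k' : ℕ) (t d : Fin k' → ℝ), IsAlgebraic ℚ r ∧ (∀ j, 1 < u j) ∧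
        (∀ j, IsAlgebraic ℚ (u j)) ∧ (∀ j, IsAlgebraic ℚ (c j)) ∧ (∀ l, 0 ≤ t l) ∧
        (∀ l, IsAlgebraic ℚ (t l)) ∧ (∀ l, IsAlgebraic ℚ (d l)) ∧
        QuotientAddGroup.mk' (relationsLE 1) (of N) = QuotientAddGroup.mk' (relationsLE 1) (of (ZA r)) +
          ∑ j, QuotientAddGroup.mk' (relationsLE 1) (of (RA 1 (u j) (c j))) +
          ∑ l, QuotientAddGroup.mk' (relationsLE 1) (of (RG (t l) (d l))) := by
  intro d
  induction d with
  | zero =>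
    intro p q N hq hdeg _ _ hNd hNi
    obtain ⟨c0, hc0⟩ : ∃ c0, q = Polynomial.C c0 :=
      ⟨q.coeff 0, Polynomial.eq_C_of_natDegree_eq_zero (Nat.le_zero.mp hdeg)⟩
    have hc00 : c0 ≠ 0 := by
      intro h; apply hq; rw [hc0, h, map_zero]
    have e0 : (algebraMap (algebraicClosure ℚ ℝ) ℝ c0 : ℝ) = (c0 : ℝ) := rfl
    exact nfD_of_nfA (nfA_poly hZ p hc00 N hNd fun x hx => by
      rw [hNi hx]
      show (Polynomial.aeval (x 0) p : ℝ) / Polynomial.aeval (x 0) q = _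
      rw [hc0, Polynomial.aeval_C, e0])
  | succ d ih =>
    intro p q N hq hdeg hdvd hq01 hNd hNi
    by_cases hd : q.natDegree ≤ d
    · exact ih p q N hq hd hdvd hq01 hNd hNi
    have hdeg' : q.natDegree = d + 1 := le_antisymm hdeg (Nat.lt_of_not_le hd)
    have hdegpos : 0 < q.natDegree := by omega
    rcases exists_root_or_quad q hdegpos hq₀ hdvd with ⟨ρ, hρ⟩ | ⟨u, v, hv0, hQdvd⟩
    · -- a real algebraic root: peel it as in the real-split case
      have hρ01 : (ρ:ℝ) ∉ Set.Icc (0:ℝ) 1 := by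
        intro h
        apply hq01 (ρ:ℝ) h
        have e : (ρ:ℝ) = algebraMap (algebraicClosure ℚ ℝ) ℝ ρ := rfl
        rw [e, Polynomial.aeval_algebraMap_apply_eq_algebraMap_eval, hρ.eq_zero, map_zero]
      obtain ⟨k, c, p₁, q₁, hq₁0, hq₁deg, hq₁dvd, hpeel⟩ := BoxAlgSplitK4.exists_peel_poleK p q hq hρ
      obtain ⟨w, hw⟩ := hq₁dvd
      have hq₁01 : ∀ t ∈ Set.Icc (0:ℝ) 1, (Polynomial.aeval t q₁ : ℝ) ≠ 0 := by
        intro t ht h; apply hq01 t ht; rw [hw, map_mul, h, zero_mul]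
      have hρt : ∀ t ∈ Set.Icc (0:ℝ) 1, t - (ρ:ℝ) ≠ 0 := by
        intro t ht h; apply hρ01; rw [sub_eq_zero] at h; rw [← h]; exact ht
      obtain ⟨T, hTd, hTi⟩ := AlgSplitK5.exists_repK_unit (Polynomial.C c)
        ((Polynomial.X - Polynomial.C ρ) ^ (k + 1)) fun t ht => by
          simp only [map_pow, map_sub, Polynomial.aeval_X, Polynomial.aeval_C]
          exact pow_ne_zero _ (hρt t ht)
      have hTi' : ∀ x, T.integrand x = (c:ℝ) / (x 0 - ρ) ^ (k + 1) := by
        intro x; rw [hTi]; simp only [map_pow, map_sub, Polynomial.aeval_X, Polynomial.aeval_C]; rfl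
      obtain ⟨N₁, hN₁d, hN₁i⟩ := AlgSplitK5.exists_repK_unit p₁ q₁ hq₁01
      have hsplit3 : of N - of T - of N₁ ∈ relationsLE 1 := by
        refine mem_relationsLE_of_integrandAdd le_rfl (by rw [hTd, hNd]) (by rw [hN₁d, hNd]) fun x hx => ?_
        rw [hNi hx, Pi.add_apply, hTi', hN₁i]
        simp only
        have hx' : x 0 ∈ Set.Icc (0:ℝ) 1 := by rw [hNd] at hx; exact Set.Ioo_subset_Icc_self hx
        rw [hpeel (x 0) (hq01 (x 0) hx')]
        rfl
      have hcA : IsAlgebraic ℚ (c : ℝ) := AlgSplitK5.isAlgebraic_coeK c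
      have hρA : IsAlgebraic ℚ (ρ : ℝ) := AlgSplitK5.isAlgebraic_coeK ρ
      have hT : ∃ (r : ℝ) (k : ℕ) (u c : Fin k → ℝ) (k' : ℕ) (t d : Fin k' → ℝ), IsAlgebraic ℚ r ∧ (∀ j, 1 < u j) ∧
          (∀ j, IsAlgebraic ℚ (u j)) ∧ (∀ j, IsAlgebraic ℚ (c j)) ∧ (∀ l, 0 ≤ t l) ∧
          (∀ l, IsAlgebraic ℚ (t l)) ∧ (∀ l, IsAlgebraic ℚ (d l)) ∧
          QuotientAddGroup.mk' (relationsLE 1) (of T) = QuotientAddGroup.mk' (relationsLE 1) (of (ZA r)) +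
            ∑ j, QuotientAddGroup.mk' (relationsLE 1) (of (RA 1 (u j) (c j))) +
            ∑ l, QuotientAddGroup.mk' (relationsLE 1) (of (RG (t l) (d l))) := by
        cases k with
        | zero =>
          exact nfD_of_nfA (SiegeK3.nfA_pole_one hR hZ hcA hρA hρ01 T hTd fun x _ => by
            rw [hTi', zero_add, pow_one])
        | succ j => exact nfD_of_nfA (nfA_pole_high hZ hcA hρA hρ01 j T hTd fun x _ => by rw [hTi'])
      have hN₁ := ih p₁ q₁ N₁ hq₁0 (by omega) ((Dvd.intro w hw.symm).trans hdvd) hq₁01 hN₁d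
        (by rw [hN₁i]; exact fun _ _ => rfl)
      have hEq := nfD_add hZ hT hN₁
      rw [← QuotientAddGroup.eq_zero_iff] at hsplit3
      change QuotientAddGroup.mk' (relationsLE 1) _ = 0 at hsplit3
      rw [map_sub, map_sub, sub_sub, sub_eq_zero] at hsplit3
      rw [hsplit3]
      exact hEq
    · -- a pair of conjugate non-real roots: peel the quadratic factor
      obtain ⟨n, A, B, p₁, q₁, hq₁0, hq₁deg, hq₁dvd, hpeel⟩ := exists_peel_quad p q hq hv0.ne' hQdvd
      obtain ⟨w, hw⟩ := hq₁dvd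
      have hq₁01 : ∀ t ∈ Set.Icc (0:ℝ) 1, (Polynomial.aeval t q₁ : ℝ) ≠ 0 := by
        intro t ht h; apply hq01 t ht; rw [hw, map_mul, h, zero_mul]
      have hAA : IsAlgebraic ℚ (A : ℝ) := AlgSplitK5.isAlgebraic_coeK A
      have hBA : IsAlgebraic ℚ (B : ℝ) := AlgSplitK5.isAlgebraic_coeK B
      have huA : IsAlgebraic ℚ (u : ℝ) := AlgSplitK5.isAlgebraic_coeK u
      have hvA : IsAlgebraic ℚ (v : ℝ) := AlgSplitK5.isAlgebraic_coeK v
      obtain ⟨T, hTd, hTi⟩ := exists_quadRep' (a := 0) (b := 1) isAlgebraic_zero isAlgebraic_one hAA hBA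
        huA hvA hv0.ne' (n + 1)
      obtain ⟨N₁, hN₁d, hN₁i⟩ := AlgSplitK5.exists_repK_unit p₁ q₁ hq₁01
      have hsplit3 : of N - of T - of N₁ ∈ relationsLE 1 := by
        refine mem_relationsLE_of_integrandAdd le_rfl (by rw [hTd, hNd]) (by rw [hN₁d, hNd]) fun x hx => ?_
        rw [hNi hx, Pi.add_apply, hTi, hN₁i]
        simp only
        have hx' : x 0 ∈ Set.Icc (0:ℝ) 1 := by rw [hNd] at hx; exact Set.Ioo_subset_Icc_self hx
        rw [hpeel (x 0) (hq01 (x 0) hx')]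
      have hT := nfD_quad hR hZ hRG isAlgebraic_zero isAlgebraic_one huA hvA hv0 zero_le_one n A B T
        hAA hBA hTd (by rw [hTi]; exact fun _ _ => rfl)
      have hN₁ := ih p₁ q₁ N₁ hq₁0 (by omega) ((Dvd.intro w hw.symm).trans hdvd) hq₁01 hN₁d
        (by rw [hN₁i]; exact fun _ _ => rfl)
      have hEq := nfD_add hZ hT hN₁
      rw [← QuotientAddGroup.eq_zero_iff] at hsplit3
      change QuotientAddGroup.mk' (relationsLE 1) _ = 0 at hsplit3
      rw [map_sub, map_sub, sub_sub, sub_eq_zero] at hsplit3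
      rw [hsplit3]
      exact hEq

/-! ## Box rigidity in dimension one -/

/-- **Conjecture 1 for box-rational representations in dimension one.** A representation on the open
unit slab with integrand `p/q` (`p, q ∈ ℚ[X]`, `q` without zeros on `[0,1]`) whose value vanishes is a
Kontsevich–Zagier relation. Proof: the class of `N` is a mixed normal form (`nfD_of_dvd`) with value
`0`, hence zero (`nfD_eq_zero_of_eval_eq_zero`, Baker). This is the `m = 1` case of the registered stub
`stub_boxRigidity` up to the standard difference trick (`box_rat_equivalent_of_value_eq`), and the
dimension-one case of item stmt-KontsevichZagierPeriods-10622; the values covered are exactly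
`ℚ̄ + Σ ℚ̄ log ℚ̄ + Σ ℚ̄·π`-type numbers such as `∫₀¹ dx/(1+x²) = π/4` and `∫₀¹ dx/(1+x³) = log 2/3 + π/(3√3)`.
(inside the budget `relationsLE 1`) [cite: KontsevichZagier2001, §1.2 Conjecture 1] -/
theorem box_rat_mem_relationsLE : ∀ (p q : Polynomial ℚ), q ≠ 0 →
    (∀ t ∈ Set.Icc (0:ℝ) 1, (Polynomial.aeval t q : ℝ) ≠ 0) →
    ∀ (N : KZ.IntegralRep 1), N.domain = {x | x 0 ∈ Set.Ioo (0:ℝ) 1} →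
    Set.EqOn N.integrand (fun x => (Polynomial.aeval (x 0) p : ℝ) / Polynomial.aeval (x 0) q)
      N.domain →
    N.value = 0 → KZ.of N ∈ KZ.relationsLE 1 := by
  intro p q hq hq01 N hNd hNi hv
  classical
  obtain ⟨RA, hR⟩ := exists_carrierA
  obtain ⟨ZA, hZ⟩ := exists_ptCarrierA
  obtain ⟨RG, hRG⟩ := exists_angCarrier
  set K := algebraicClosure ℚ ℝ
  have hqK0 : q.map (algebraMap ℚ K) ≠ 0 := (Polynomial.map_ne_zero_iff (algebraMap ℚ K).injective).mpr hq
  have haevq : ∀ t : ℝ, (Polynomial.aeval t (q.map (algebraMap ℚ K)) : ℝ) = Polynomial.aeval t q :=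
    fun t => Polynomial.aeval_map_algebraMap K t q
  have haevp : ∀ t : ℝ, (Polynomial.aeval t (p.map (algebraMap ℚ K)) : ℝ) = Polynomial.aeval t p :=
    fun t => Polynomial.aeval_map_algebraMap K t p
  obtain ⟨r, k, u, c, k', t, d, hr, hu1, hu, hc, ht0, ht, hd, hEq⟩ :=
    nfD_of_dvd hR hZ hRG hq _ (p.map (algebraMap ℚ K)) (q.map (algebraMap ℚ K)) N hqK0 le_rfl dvd_rfl
      (fun t ht => by rw [haevq]; exact hq01 t ht) hNd
      (fun x hx => by
        rw [hNi hx]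
        show (Polynomial.aeval (x 0) p : ℝ) / Polynomial.aeval (x 0) q =
          Polynomial.aeval (x 0) (p.map (algebraMap ℚ K)) / Polynomial.aeval (x 0) (q.map (algebraMap ℚ K))
        rw [haevp, haevq])
  have h := nfD_eq_zero_of_eval_eq_zero hR hZ hRG (of N) hr hu1 hu hc ht0 ht hd hEq (by rw [eval_of, hv])
  exact (QuotientAddGroup.eq_zero_iff _).mp h

/-- **Box rigidity in dimension one.** Two representations on the open unit slab with integrands
`p/q`, `p'/q'` (`p, q, p', q' ∈ ℚ[X]`, denominators without zeros on `[0,1]`) and equal values are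
KZ-equivalent INSIDE DIMENSION ONE (`KZ.EquivalentLE 1`) — the full `m = m' = 1` instance of the registered stub `stub_boxRigidity`, with
values in `ℚ̄ + Σ ℚ̄ log ℚ̄ + ℚ̄π`. Input: Baker's theorem (`baker_holds`).
(inside the budget `relationsLE 1`) [cite: KontsevichZagier2001, §1.2 Conjecture 1] -/
theorem box_rat_equivalentLE_of_value_eq (p q p' q' : ℚ[X]) (hq : q ≠ 0)
    (hq01 : ∀ t ∈ Set.Icc (0:ℝ) 1, (Polynomial.aeval t q : ℝ) ≠ 0) (hq' : q' ≠ 0)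
    (hq'01 : ∀ t ∈ Set.Icc (0:ℝ) 1, (Polynomial.aeval t q' : ℝ) ≠ 0)
    (N N' : IntegralRep 1) (hNd : N.domain = {x | x 0 ∈ Set.Ioo (0:ℝ) 1})
    (hNi : EqOn N.integrand (fun x => (Polynomial.aeval (x 0) p : ℝ) / Polynomial.aeval (x 0) q)
      N.domain)
    (hN'd : N'.domain = {x | x 0 ∈ Set.Ioo (0:ℝ) 1})
    (hN'i : EqOn N'.integrand (fun x => (Polynomial.aeval (x 0) p' : ℝ) / Polynomial.aeval (x 0) q')
      N'.domain)
    (hv : N.value = N'.value) : EquivalentLE 1 N N' := by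
  have hqq01 : ∀ t ∈ Set.Icc (0:ℝ) 1, (Polynomial.aeval t (q * q') : ℝ) ≠ 0 := fun t ht => by
    rw [map_mul]; exact mul_ne_zero (hq01 t ht) (hq'01 t ht)
  obtain ⟨D, hDd, hDi⟩ := exists_rep_unit (p * q' - p' * q) (q * q') hqq01
  obtain ⟨M, hMd, hMi⟩ := exists_rep_unit (-p') q' hq'01
  have h1 : of D - of N - of M ∈ relationsLE 1 := by
    refine mem_relationsLE_of_integrandAdd le_rfl (by rw [hNd, hDd]) (by rw [hMd, hDd]) fun x hx => ?_
    have hx' : x 0 ∈ Set.Icc (0:ℝ) 1 := by rw [hDd] at hx; exact Set.Ioo_subset_Icc_self hx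
    rw [Pi.add_apply, hDi, hMi, hNi (by rw [hNd, ← hDd]; exact hx)]
    simp only [map_sub, map_mul, map_neg]
    have h1 := hq01 _ hx'
    have h2 := hq'01 _ hx'
    field_simp
    ring
  have h2 : of N' + of M ∈ relationsLE 1 :=
    Kit.of_add_of_mem_relationsLE_of_eqOn_neg le_rfl (by rw [hMd, hN'd]) fun x hx => by
      rw [hMi, Pi.neg_apply, hN'i hx]
      simp [neg_div]
  have hvM : M.value = -N'.value := by
    have h := Budget.eval_eq_zero_of_mem_relationsLE h2
    rw [map_add, eval_of, eval_of] at h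
    linarith
  have hvD : D.value = 0 := by
    have h := Budget.eval_eq_zero_of_mem_relationsLE h1
    rw [map_sub, map_sub, eval_of, eval_of, eval_of] at h
    linarith
  have hD : of D ∈ relationsLE 1 :=
    box_rat_mem_relationsLE _ _ (mul_ne_zero hq hq') hqq01 D hDd (by rw [hDi]; exact fun _ _ => rfl) hvD
  have : of N - of N' = of D - (of D - of N - of M) - (of N' + of M) := by abel
  show of N - of N' ∈ relationsLE 1
  rw [this]
  exact (relationsLE 1).sub_mem ((relationsLE 1).sub_mem hD h1) h2

end Dlog


end Summit.KontsevichZagierPeriods.AbelContraction.RealHyperellipticSector.Port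

end
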